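import Mathlib
import Summits.PneNP.PneNP.Theses.KrwChromaticSteering
import Summits.PneNP.PneNP.Theorems.KrwChromaticSteeringStrongCompositionLradDefs

/-!
# Route KrwChromaticSteering, crux `StrongComposition` (stmt-PneNP-18538) — route link for the LRAD rung

This leaf module carries the single theorem linking the route statement
`Summit.PneNP.PneNP.Theses.KrwChromaticSteering.StrongComposition` (C1) to the route-independent rung
`StrongCompositionLRAD` of `KrwChromaticSteeringStrongCompositionLradDefs`. It was moved here verbatim from
`KrwChromaticSteeringStrongCompositionLradDefs` so that the LRAD/LRB cone of landed `Theorems` files is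
route-independent (no `Theses` import), per the operator maintenance edit requested by the crux lead
(stmt-PneNP-18538) on 2026-08-29. Statement and proof are unchanged.
-/

namespace Summit.PneNP.PneNP.Theorems.KrwLrad

open Literature.Computability.Complexity

/-- C1 implies its LRAD restriction (a refutation of the rung would refute C1; a proof is a rung). -/
theorem lrad_of_strongComposition :
    Theses.KrwChromaticSteering.StrongComposition → StrongCompositionLRAD := by
  rintro ⟨c, h⟩
  refine ⟨c, fun m n hn f hf => ?_⟩
  obtain ⟨g, hg⟩ := h m n hn f hf
  exact ⟨g, fun P _ hP => hg P hP⟩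

end Summit.PneNP.PneNP.Theorems.KrwLrad
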